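import Literature.Barriers.Parity.SiegelZeroPrimePairsDyadicSmoothing
import Literature.NumberTheory.Sieve.PrimePairsVonMangoldtBound
import HarnessLib

/-!
# Matomäki–Merikoski Theorem 1.3: the degenerate regimes (odd shift, small `η`, large error)

Topic `Literature/Barriers/Parity`; sibling of `SiegelZeroPrimePairsDyadicSmoothing.lean`, whose theorem
`MatomakiMerikoski2023_pairCorrelation_of_smoothed'` reduces the named fact
`Literature.Barriers.Parity.MatomakiMerikoski2023_pairCorrelation` (Matomäki–Merikoski, IMRN 2023,
arXiv:2112.11412, Theorem 1.3) to its SMOOTHED dyadic form `H` (all shifts `h ≥ 1`, all `η ≥ 10`).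
Everything in this file is PROVED; no definition and no named fact is introduced.

§7 of the source opens: "Theorems 1.2 and 1.3 are trivial unless `h` is even.  Furthermore they follow
from Lemma 3.1(i) with `w₁ = w₂ = X^{1/4}` and `m₁ = m₂ = 0` [the sieve bound
`∑_{n ≤ X} Λ(n)Λ(n+h) ≪ (h/φ(h)) X`] unless `η` is large."  This file carries out exactly these two
reductions (and the companion normalisation "the error term is `≤ 1`", i.e. `V log⁶η/η ≤ 1`, without
which the statement is again implied by the sieve bound) at the level of the smoothed statement `H`:

* `MMSmoothing.smoothed_of_core` — `H` follows from its restriction `H_core` to EVEN shifts `h`, to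
  `η ≥ η₀` for any threshold `η₀ = η₀(C, ε, A)` chosen by the prover of `H_core`, and to the range
  `(log x/log q) · log⁶η/η ≤ 1`.  Inputs: the tree's sieve bound
  `PrimePairsVonMangoldt.sum_vonMangoldt_mul_shift_le` (`∑_{n ≤ N} Λ(n)Λ(n+h) ≤ C (h/φ(h)) N`,
  `h ≤ N²`), the odd-shift bound `PrimePairsVonMangoldt.sum_vonMangoldt_mul_shift_le_of_odd`
  (`≪ log³`), `𝔖(h) = 0` for odd `h`, `𝔖(h) ≤ 6 h/φ(h)`, `|corr| ≤ 1`, `0 ≤ ∫ g ≤ 1`, and the absorption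
  `x^{−1/1000} ≪_{C,ε} exp(−C (log x)^{3/5−ε})` (`exists_rpow_neg_le_mul_exp`).
* `MatomakiMerikoski2023_pairCorrelation_of_core` — composition with
  `MatomakiMerikoski2023_pairCorrelation_of_smoothed'`: the named fact follows from `H_core`.

`H_core` is what §§2–7 of the source (decomposition (2.5), Lemmas 2.1–2.5, Proposition 2.3 and the
assembly of §7) actually address; it is taken here as an explicit hypothesis, written out in full.

## References

* K. Matomäki, J. Merikoski, IMRN 2023:23, 20337–20384 (arXiv:2112.11412), §7, first paragraph;
  §2, first two paragraphs. [cite: MatomakiMerikoski2023, §7]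
-/

noncomputable section

open Finset Real
open scoped ArithmeticFunction.vonMangoldt

namespace Literature.Barriers.Parity

open Literature.NumberTheory.Sieve (goldbachSingularSeries plateauCutoff plateauCutoff_nonneg
  plateauCutoff_le_one sub_le_integral_plateauCutoff integral_plateauCutoff_le)
open Literature.NumberTheory.Sieve.PrimePairsVonMangoldt (sum_vonMangoldt_mul_shift_le
  sum_vonMangoldt_mul_shift_le_of_odd)

namespace MMSmoothing

/-! ### Elementary bounds for the smoothed sum and the main term -/

/-- The smoothed correlation is bounded by the unsmoothed one: `0 ≤ g ≤ 1` and `Λ(n)Λ(n+h) ≥ 0`.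
[folklore] -/
theorem abs_sum_smooth_le {x δ : ℝ} (hδ0 : 0 < δ) (hδ : δ ≤ 1 / 2) (h : ℕ) :
    |∑ n ∈ Icc 1 ⌊2 * x⌋₊, plateauCutoff (1 + δ) (2 - δ) δ (n / x) * (Λ n * Λ (n + h))| ≤
      ∑ n ∈ Icc 1 ⌊2 * x⌋₊, Λ n * Λ (n + h) := by
  have hab : 1 + δ ≤ 2 - δ := by linarith
  refine (abs_sum_le_sum_abs _ _).trans (Finset.sum_le_sum fun n _ => ?_)
  rw [abs_mul, abs_of_nonneg (vonMangoldt_mul_nonneg n (n + h))]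
  calc |plateauCutoff (1 + δ) (2 - δ) δ (n / x)| * (Λ n * Λ (n + h))
      ≤ 1 * (Λ n * Λ (n + h)) := by
        refine mul_le_mul_of_nonneg_right ?_ (vonMangoldt_mul_nonneg n (n + h))
        rw [abs_of_nonneg (plateauCutoff_nonneg hδ0 hab _)]
        exact plateauCutoff_le_one hδ0 hab _
    _ = Λ n * Λ (n + h) := one_mul _

/-- `0 ≤ ∫ g ≤ 1` for `g = plateauCutoff (1+δ) (2−δ) δ`, `0 < δ ≤ 1/2`. [folklore] -/
theorem integral_plateauCutoff_mem {δ : ℝ} (hδ0 : 0 < δ) (hδ : δ ≤ 1 / 2) :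
    0 ≤ ∫ u, plateauCutoff (1 + δ) (2 - δ) δ u ∧ ∫ u, plateauCutoff (1 + δ) (2 - δ) δ u ≤ 1 := by
  have hab : 1 + δ ≤ 2 - δ := by linarith
  constructor
  · have := sub_le_integral_plateauCutoff hδ0 hab; linarith
  · have := integral_plateauCutoff_le hδ0 hab; linarith

/-- The crude bound `∑_{n ≤ N} Λ(n)Λ(n+h) ≤ N log²(N + h)`. [folklore] -/
theorem sum_vonMangoldt_mul_le_card_mul_log_sq (N h : ℕ) :
    ∑ n ∈ Icc 1 N, Λ n * Λ (n + h) ≤ N * Real.log ((N : ℝ) + h) ^ 2 := by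
  calc ∑ n ∈ Icc 1 N, Λ n * Λ (n + h) ≤ ∑ n ∈ Icc 1 N, Real.log ((N : ℝ) + h) ^ 2 := by
        refine Finset.sum_le_sum fun n hn => ?_
        rw [Finset.mem_Icc] at hn
        exact vonMangoldt_mul_le_log_sq (by exact_mod_cast (show n + h ≤ N + h by omega)) hn.1
    _ = N * Real.log ((N : ℝ) + h) ^ 2 := by rw [Finset.sum_const, Nat.card_Icc, nsmul_eq_mul]; simp

/-- `𝔖(h) = 0` for odd `h`. [folklore] -/
theorem goldbachSingularSeries_of_odd {h : ℕ} (hh : Odd h) : goldbachSingularSeries h = 0 := by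
  unfold goldbachSingularSeries; rw [if_pos hh]

/-! ### The reduction to the core regime -/

set_option maxHeartbeats 800000 in
/-- **The degenerate regimes of Matomäki–Merikoski Theorem 1.3 (smoothed form).**  The smoothed dyadic
statement `H'` of `MatomakiMerikoski2023_pairCorrelation_of_smoothed'` (all `h ≥ 1`, all `η ≥ 10`) follows
from its restriction `H_core` to even `h`, to `η ≥ η₀` (any threshold `η₀` depending on `C, ε, A`) and
to `(log x/log q) log⁶η/η ≤ 1`: for odd `h` the main term vanishes (`𝔖(h) = 0`) and the sum is
`≪_A log³ x ≤ K x exp(−C (log x)^{3/5−ε})`; if `η < η₀` or `(log x/log q) log⁶η/η > 1` the error factor is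
`≥ min(1, 512/max(η₀,10))` while sum and main term are both `≪_A (h/φ(h)) x` by the sieve bound
`sum_vonMangoldt_mul_shift_le` ("[Theorem 1.3 follows] from Lemma 3.1(i) ... unless `η` is large",
§7 of the source). [cite: MatomakiMerikoski2023, §7 first paragraph] -/
theorem smoothed_of_core
    (Hcore : ∀ C : ℝ, 1 ≤ C → ∀ ε : ℝ, 0 < ε → ∀ A : ℝ, 0 < A → ∃ η₀ K : ℝ, 0 < K ∧
      ∀ (q : ℕ) [NeZero q], 3 ≤ q → ∀ χ : DirichletCharacter ℂ q, χ.IsPrimitive → χ.IsQuadratic →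
        ∀ η : ℝ, 10 ≤ η → η₀ ≤ η → χ.LFunction ((1 - 1 / (η * Real.log q) : ℝ) : ℂ) = 0 →
          ∀ x : ℝ, (q : ℝ) ^ (37 / 4 : ℝ) ≤ x → Real.log x / Real.log q * Real.log η ^ (6 : ℕ) / η ≤ 1 →
            ∀ δ : ℝ, x ^ (-(1 / 999 : ℝ)) / 4 ≤ δ → δ ≤ x ^ (-(1 / 1000 : ℝ)) → δ ≤ 1 / 2 →
            ∀ h : ℕ, 1 ≤ h → Even h → (h : ℝ) ≤ A * x ^ (1 + 1 / 3999 : ℝ) →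
              |(∑ n ∈ Icc 1 ⌊2 * x⌋₊,
                  plateauCutoff (1 + δ) (2 - δ) δ (n / x) * (Λ n * Λ (n + h))) -
                  x * (∫ u, plateauCutoff (1 + δ) (2 - δ) δ u) * goldbachSingularSeries h *
                    (1 + if Nat.totient (2 ^ padicValNat 2 q) ∣ h then
                          (-1 : ℝ) ^ (h / Nat.totient (2 ^ padicValNat 2 q)) *
                            ∏ p ∈ (q / 2 ^ padicValNat 2 q).primeFactors.filter (fun p => ¬ p ∣ h),
                              (-1 : ℝ) / ((p : ℝ) - 2)
                        else 0)| ≤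
                K * ((h : ℝ) / (Nat.totient h : ℝ)) * x *
                  (Real.exp (-C * Real.sqrt (Real.log x / Real.log q * Real.log η)) +
                    Real.exp (-C * Real.log x ^ (3 / 5 - ε)) +
                    Real.log x / Real.log q * Real.log η ^ (6 : ℕ) / η)) :
    ∀ C : ℝ, 1 ≤ C → ∀ ε : ℝ, 0 < ε → ∀ A : ℝ, 0 < A → ∃ K : ℝ, 0 < K ∧
      ∀ (q : ℕ) [NeZero q], 3 ≤ q → ∀ χ : DirichletCharacter ℂ q, χ.IsPrimitive → χ.IsQuadratic →
        ∀ η : ℝ, 10 ≤ η → χ.LFunction ((1 - 1 / (η * Real.log q) : ℝ) : ℂ) = 0 →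
          ∀ x : ℝ, (q : ℝ) ^ (37 / 4 : ℝ) ≤ x →
            ∀ δ : ℝ, x ^ (-(1 / 999 : ℝ)) / 4 ≤ δ → δ ≤ x ^ (-(1 / 1000 : ℝ)) → δ ≤ 1 / 2 →
            ∀ h : ℕ, 1 ≤ h → (h : ℝ) ≤ A * x ^ (1 + 1 / 3999 : ℝ) →
              |(∑ n ∈ Icc 1 ⌊2 * x⌋₊,
                  plateauCutoff (1 + δ) (2 - δ) δ (n / x) * (Λ n * Λ (n + h))) -
                  x * (∫ u, plateauCutoff (1 + δ) (2 - δ) δ u) * goldbachSingularSeries h *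
                    (1 + if Nat.totient (2 ^ padicValNat 2 q) ∣ h then
                          (-1 : ℝ) ^ (h / Nat.totient (2 ^ padicValNat 2 q)) *
                            ∏ p ∈ (q / 2 ^ padicValNat 2 q).primeFactors.filter (fun p => ¬ p ∣ h),
                              (-1 : ℝ) / ((p : ℝ) - 2)
                        else 0)| ≤
                K * ((h : ℝ) / (Nat.totient h : ℝ)) * x *
                  (Real.exp (-C * Real.sqrt (Real.log x / Real.log q * Real.log η)) +
                    Real.exp (-C * Real.log x ^ (3 / 5 - ε)) +
                    Real.log x / Real.log q * Real.log η ^ (6 : ℕ) / η) := by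
  intro C hC ε hε A hA
  obtain ⟨η₀, K₁, hK₁, H₁⟩ := Hcore C hC ε hε A hA
  obtain ⟨CB, hCB, HB⟩ := sum_vonMangoldt_mul_shift_le
  obtain ⟨Ke, hKe, He⟩ := exists_rpow_neg_le_mul_exp C hε
  -- constants
  set η₁ : ℝ := max η₀ 10 with hη₁
  have hη₁0 : 0 < η₁ := lt_of_lt_of_le (by norm_num) (le_max_right _ _)
  set c₀ : ℝ := min 1 (512 / η₁) with hc₀
  have hc₀0 : 0 < c₀ := lt_min one_pos (by positivity)
  have hc₀1 : c₀ ≤ 1 := min_le_left _ _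
  set LA : ℝ := Real.log (2 + A) + 1.06 * Real.log A with hLA
  set aA : ℝ := Real.log (2 + A) + 1.01 with haA
  have haA1 : 1 ≤ aA := by
    have : 0 ≤ Real.log (2 + A) := Real.log_nonneg (by linarith)
    rw [haA]; linarith
  set KT : ℝ := (2 * CB + 2 * LA ^ 2 + 12) / c₀ with hKT
  have hKT0 : 0 < KT := by positivity
  set KO : ℝ := 8748 * aA ^ 2 * Ke with hKO
  have hKO0 : 0 < KO := by positivity
  refine ⟨K₁ + KT + KO, by positivity, ?_⟩
  intro q _ hq χ hprim hquad η hη hL x hx δ hδ hδup hδ2 h hh hhA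
  -- basic facts
  have hq2 : (3 : ℝ) ≤ q := by exact_mod_cast hq
  have hq8 : (256 : ℝ) ≤ (q : ℝ) ^ (37 / 4 : ℝ) := by
    have h9 : (3 : ℝ) ^ (9 : ℕ) = (3 : ℝ) ^ (9 : ℝ) := by exact_mod_cast (Real.rpow_natCast (3 : ℝ) 9).symm
    calc (256 : ℝ) ≤ (3 : ℝ) ^ (9 : ℕ) := by norm_num
      _ = (3 : ℝ) ^ (9 : ℝ) := h9
      _ ≤ (3 : ℝ) ^ (37 / 4 : ℝ) := Real.rpow_le_rpow_of_exponent_le (by norm_num) (by norm_num)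
      _ ≤ (q : ℝ) ^ (37 / 4 : ℝ) := Real.rpow_le_rpow (by norm_num) hq2 (by norm_num)
  have hx256 : (256 : ℝ) ≤ x := hq8.trans hx
  have hx1 : (1 : ℝ) ≤ x := by linarith
  have hx0 : 0 < x := by linarith
  have hlogq : 0 < Real.log q := Real.log_pos (by linarith)
  have hlogx : Real.log 256 ≤ Real.log x := Real.log_le_log (by norm_num) hx256
  have hlog256 : (5.5 : ℝ) ≤ Real.log 256 := by
    rw [show (256 : ℝ) = 2 ^ 8 by norm_num, Real.log_pow]
    have := Real.log_two_gt_d9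
    push_cast; linarith only [this]
  have hlogx5 : (5.5 : ℝ) ≤ Real.log x := hlog256.trans hlogx
  have hlogx0 : 0 < Real.log x := by linarith
  have hη0 : 0 < η := by linarith
  have hlogη : 2 ≤ Real.log η := by
    have hlog10 : (2 : ℝ) < Real.log 10 := by
      rw [Real.lt_log_iff_exp_lt (by norm_num)]
      have h1 : Real.exp 1 < 2.7182818286 := Real.exp_one_lt_d9
      have h2 : Real.exp 2 = Real.exp 1 * Real.exp 1 := by rw [← Real.exp_add]; norm_num
      rw [h2]; nlinarith [Real.exp_pos 1]
    have := Real.log_le_log (by norm_num) hη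
    linarith
  have hlogη6 : (64 : ℝ) ≤ Real.log η ^ (6 : ℕ) := by
    have := pow_le_pow_left₀ (by norm_num : (0 : ℝ) ≤ 2) hlogη 6
    norm_num at this; linarith
  have hV0 : 0 ≤ Real.log x / Real.log q := div_nonneg hlogx0.le hlogq.le
  have hterm0 : 0 ≤ Real.log x / Real.log q * Real.log η ^ (6 : ℕ) / η :=
    div_nonneg (mul_nonneg hV0 (pow_nonneg (by linarith) 6)) hη0.le
  have hV' : 8 ≤ Real.log x / Real.log q := by
    rw [le_div_iff₀ hlogq]
    have : Real.log ((q : ℝ) ^ (37 / 4 : ℝ)) ≤ Real.log x := Real.log_le_log (by positivity) hx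
    rw [Real.log_rpow (by linarith)] at this
    nlinarith only [this, hlogq]
  -- the error factor
  set E : ℝ := Real.exp (-C * Real.sqrt (Real.log x / Real.log q * Real.log η)) +
      Real.exp (-C * Real.log x ^ (3 / 5 - ε)) +
      Real.log x / Real.log q * Real.log η ^ (6 : ℕ) / η with hE
  have hE3 : Real.log x / Real.log q * Real.log η ^ (6 : ℕ) / η ≤ E := by
    rw [hE]; linarith [Real.exp_pos (-C * Real.sqrt (Real.log x / Real.log q * Real.log η)),
      Real.exp_pos (-C * Real.log x ^ (3 / 5 - ε))]
  have hE2 : Real.exp (-C * Real.log x ^ (3 / 5 - ε)) ≤ E := by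
    rw [hE]
    linarith only [Real.exp_pos (-C * Real.sqrt (Real.log x / Real.log q * Real.log η)), hterm0]
  have hE0 : 0 < E := lt_of_lt_of_le (Real.exp_pos _) hE2
  have hEη : 512 / η ≤ E := by
    refine le_trans ?_ hE3
    have h1 : (512 : ℝ) ≤ Real.log x / Real.log q * Real.log η ^ (6 : ℕ) := by
      calc (512 : ℝ) = 8 * 64 := by norm_num
        _ ≤ Real.log x / Real.log q * Real.log η ^ (6 : ℕ) :=
            mul_le_mul hV' hlogη6 (by norm_num) hV0
    exact div_le_div_of_nonneg_right h1 hη0.le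
  -- the weight, the harmless factors
  have hδ0 : 0 < δ := by
    have : 0 < x ^ (-(1 / 999 : ℝ)) / 4 := by positivity
    linarith
  set g : ℝ → ℝ := plateauCutoff (1 + δ) (2 - δ) δ with hg
  obtain ⟨hI0, hI1⟩ := integral_plateauCutoff_mem hδ0 hδ2
  set corr : ℝ := (if Nat.totient (2 ^ padicValNat 2 q) ∣ h then
      (-1 : ℝ) ^ (h / Nat.totient (2 ^ padicValNat 2 q)) *
        ∏ p ∈ (q / 2 ^ padicValNat 2 q).primeFactors.filter (fun p => ¬ p ∣ h),
          (-1 : ℝ) / ((p : ℝ) - 2)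
      else 0) with hcorr_def
  have hcorr1 : |1 + corr| ≤ 2 := by
    have h1 := abs_corr_le_one q h
    have := abs_add_le (1 : ℝ) corr; rw [abs_one] at this; linarith
  set w : ℝ := (h : ℝ) / (Nat.totient h : ℝ) with hw
  have hh0 : h ≠ 0 := by omega
  have hφ0 : (0 : ℝ) < Nat.totient h := by exact_mod_cast Nat.totient_pos.mpr (by omega)
  have hw1 : 1 ≤ w := by rw [hw, le_div_iff₀ hφ0, one_mul]; exact_mod_cast Nat.totient_le h
  have hS6 : goldbachSingularSeries h ≤ 6 * w := goldbachSingularSeries_le_mul_div_totient hh0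
  have hS0 : 0 ≤ goldbachSingularSeries h :=
    Literature.NumberTheory.Sieve.SingularSeriesMean.goldbachSingularSeries_nonneg h
  -- the main term is `≤ 12 w x` in modulus
  have hmain : |x * (∫ u, g u) * goldbachSingularSeries h * (1 + corr)| ≤ 12 * w * x := by
    rw [abs_mul, abs_mul, abs_mul, abs_of_pos hx0, abs_of_nonneg hI0, abs_of_nonneg hS0]
    calc x * (∫ u, g u) * goldbachSingularSeries h * |1 + corr|
        ≤ x * 1 * (6 * w) * 2 := by gcongr
      _ = 12 * w * x := by ring
  -- the integer range
  set N : ℕ := ⌊2 * x⌋₊ with hN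
  have hN2x : (N : ℝ) ≤ 2 * x := Nat.floor_le (by linarith)
  have hxN : x ≤ N := by
    have := Nat.lt_floor_add_one (2 * x); rw [← hN] at this; linarith
  have hN2 : 2 ≤ N := by
    rw [hN]; exact Nat.le_floor (by push_cast; linarith)
  have hN0 : (0 : ℝ) < N := by exact_mod_cast (show 0 < N by omega)
  have hsmooth := abs_sum_smooth_le (x := x) hδ0 hδ2 h
  -- `N + h ≤ (2 + A) x^{1.01}`
  have hx101 : x ≤ x ^ (1 + 1 / 3999 : ℝ) := by
    calc x = x ^ (1 : ℝ) := (Real.rpow_one x).symm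
      _ ≤ x ^ (1 + 1 / 3999 : ℝ) := Real.rpow_le_rpow_of_exponent_le hx1 (by norm_num)
  have hNh : (N : ℝ) + h ≤ (2 + A) * x ^ (1 + 1 / 3999 : ℝ) := by
    have : (2 + A) * x ^ (1 + 1 / 3999 : ℝ) = 2 * x ^ (1 + 1 / 3999 : ℝ) + A * x ^ (1 + 1 / 3999 : ℝ) := by
      ring
    rw [this]; linarith only [hN2x, hx101, hhA]
  have hlogNh : Real.log ((N : ℝ) + h) ≤ Real.log (2 + A) + 1.01 * Real.log x := by
    have h0 : (0 : ℝ) < (N : ℝ) + h := by positivity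
    calc Real.log ((N : ℝ) + h) ≤ Real.log ((2 + A) * x ^ (1 + 1 / 3999 : ℝ)) := Real.log_le_log h0 hNh
      _ = Real.log (2 + A) + (1 + 1 / 3999) * Real.log x := by
          rw [Real.log_mul (by positivity) (by positivity), Real.log_rpow hx0]
      _ ≤ Real.log (2 + A) + 1.01 * Real.log x := by nlinarith only [hlogx0]
  have hlogNh' : Real.log ((N : ℝ) + h) ≤ aA * Real.log x := by
    have h2A : 0 ≤ Real.log (2 + A) := Real.log_nonneg (by linarith)
    have hm : 0 ≤ Real.log (2 + A) * (Real.log x - 1) := mul_nonneg h2A (by linarith only [hlogx5])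
    calc Real.log ((N : ℝ) + h) ≤ Real.log (2 + A) + 1.01 * Real.log x := hlogNh
      _ ≤ Real.log (2 + A) * Real.log x + 1.01 * Real.log x := by linarith only [hm]
      _ = aA * Real.log x := by rw [haA]; ring
  have hlogNh0 : 0 ≤ Real.log ((N : ℝ) + h) := Real.log_nonneg (by
    have : (2 : ℝ) ≤ N := by exact_mod_cast hN2
    have : (0 : ℝ) ≤ h := Nat.cast_nonneg h
    linarith)
  ------------------------------------------------------------------
  -- Regime T: the error factor is `≥ c₀`
  ------------------------------------------------------------------
  by_cases hT : c₀ ≤ E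
  · have hsumle : ∑ n ∈ Icc 1 N, Λ n * Λ (n + h) ≤ (2 * CB + 2 * LA ^ 2) * w * x := by
      by_cases hAx : A ≤ x ^ (3998 / 3999 : ℝ)
      · -- sieve bound: `h ≤ A x^{1+1/3999} ≤ x^{1−1/3999} x^{1+1/3999} = x² ≤ N²`
        have hhN2 : (h : ℝ) ≤ (N : ℝ) ^ 2 := by
          calc (h : ℝ) ≤ A * x ^ (1 + 1 / 3999 : ℝ) := hhA
            _ ≤ x ^ (3998 / 3999 : ℝ) * x ^ (1 + 1 / 3999 : ℝ) :=
                mul_le_mul_of_nonneg_right hAx (by positivity)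
            _ = x ^ 2 := by
                rw [← Real.rpow_add hx0, ← Real.rpow_natCast]; norm_num
            _ ≤ (N : ℝ) ^ 2 := pow_le_pow_left₀ hx0.le hxN 2
        have hhN2' : h ≤ N ^ 2 := by exact_mod_cast hhN2
        calc ∑ n ∈ Icc 1 N, Λ n * Λ (n + h) ≤ CB * ((h : ℝ) / Nat.totient h) * N := HB N h hN2 hh hhN2'
          _ ≤ CB * w * (2 * x) := by rw [← hw]; gcongr
          _ = 2 * CB * w * x := by ring
          _ ≤ (2 * CB + 2 * LA ^ 2) * w * x := by
              have : 0 ≤ 2 * LA ^ 2 * w * x := by positivity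
              linarith
      · -- `x^{1−1/3999} < A`: everything is bounded in terms of `A`
        push Not at hAx
        have hx99 : (1 : ℝ) ≤ x ^ (3998 / 3999 : ℝ) := Real.one_le_rpow hx1 (by norm_num)
        have hA1 : 1 < A := lt_of_le_of_lt hx99 hAx
        have hlogA : 3998 / 3999 * Real.log x < Real.log A := by
          have := Real.log_lt_log (by positivity) hAx
          rwa [Real.log_rpow hx0] at this
        have hlApos : 0 < Real.log A := Real.log_pos hA1
        have hlogxA : Real.log x ≤ 1.04 * Real.log A := by linarith only [hlogA, hlApos.le]
        have hLA' : Real.log ((N : ℝ) + h) ≤ LA := by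
          calc Real.log ((N : ℝ) + h) ≤ Real.log (2 + A) + 1.01 * Real.log x := hlogNh
            _ ≤ Real.log (2 + A) + 1.06 * Real.log A := by linarith only [hlogxA, hlApos.le]
            _ = LA := by rw [hLA]
        have hLA0 : 0 ≤ LA := hlogNh0.trans hLA'
        calc ∑ n ∈ Icc 1 N, Λ n * Λ (n + h) ≤ N * Real.log ((N : ℝ) + h) ^ 2 :=
              sum_vonMangoldt_mul_le_card_mul_log_sq N h
          _ ≤ (2 * x) * LA ^ 2 := by
              gcongr
          _ ≤ (2 * x) * LA ^ 2 * w := le_mul_of_one_le_right (by positivity) hw1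
          _ = 2 * LA ^ 2 * w * x := by ring
          _ ≤ (2 * CB + 2 * LA ^ 2) * w * x := by
              have : 0 ≤ 2 * CB * w * x := by positivity
              linarith
    have hKTc : (2 * CB + 2 * LA ^ 2 + 12) = KT * c₀ := by
      rw [hKT]; field_simp
    calc |(∑ n ∈ Icc 1 N, g (n / x) * (Λ n * Λ (n + h))) -
            x * (∫ u, g u) * goldbachSingularSeries h * (1 + corr)|
        ≤ |∑ n ∈ Icc 1 N, g (n / x) * (Λ n * Λ (n + h))| +
            |x * (∫ u, g u) * goldbachSingularSeries h * (1 + corr)| := abs_sub _ _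
      _ ≤ (2 * CB + 2 * LA ^ 2) * w * x + 12 * w * x := add_le_add (hsmooth.trans hsumle) hmain
      _ = KT * c₀ * w * x := by rw [← hKTc]; ring
      _ ≤ KT * E * w * x := by gcongr
      _ ≤ (K₁ + KT + KO) * w * x * E := by
          have h0 : 0 ≤ (K₁ + KO) * w * x * E := by positivity
          have e : (K₁ + KT + KO) * w * x * E = KT * E * w * x + (K₁ + KO) * w * x * E := by ring
          rw [e]; linarith only [h0]
  push Not at hT
  ------------------------------------------------------------------
  -- Regime O: odd `h`
  ------------------------------------------------------------------
  by_cases hodd : Odd h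
  · have hmain0 : x * (∫ u, g u) * goldbachSingularSeries h * (1 + corr) = 0 := by
      rw [goldbachSingularSeries_of_odd hodd]; ring
    -- `∑ ≤ 12 aA² log³ x`
    have hl2 : (0.6931471803 : ℝ) < Real.log 2 := Real.log_two_gt_d9
    have hNat : (Nat.log 2 (N + h) : ℝ) ≤ Real.log ((N : ℝ) + h) / Real.log 2 := by
      rw [le_div_iff₀ (by linarith), ← Real.log_pow]
      have : ((2 ^ Nat.log 2 (N + h) : ℕ) : ℝ) ≤ (N : ℝ) + h := by
        exact_mod_cast Nat.pow_log_le_self 2 (by omega)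
      push_cast at this
      exact Real.log_le_log (by positivity) this
    have hlogN : Real.log N ≤ 2 * Real.log x := by
      calc Real.log N ≤ Real.log (2 * x) := Real.log_le_log hN0 hN2x
        _ = Real.log 2 + Real.log x := Real.log_mul (by norm_num) hx0.ne'
        _ ≤ 2 * Real.log x := by
            have : Real.log 2 < 0.6931471808 := Real.log_two_lt_d9
            linarith
    have hlogN0 : 0 ≤ Real.log N := Real.log_nonneg (by exact_mod_cast (show 1 ≤ N by omega))
    have hodd_sum : ∑ n ∈ Icc 1 N, Λ n * Λ (n + h) ≤ 12 * aA ^ 2 * Real.log x ^ 3 := by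
      have h1 := sum_vonMangoldt_mul_shift_le_of_odd (N := N) hodd
      have hfac1 : 2 * ((Nat.log 2 (N + h) : ℝ) + 1) ≤ 6 * (aA * Real.log x) := by
        have h3 : (Nat.log 2 (N + h) : ℝ) ≤ 2 * (aA * Real.log x) := by
          calc (Nat.log 2 (N + h) : ℝ) ≤ Real.log ((N : ℝ) + h) / Real.log 2 := hNat
            _ ≤ (aA * Real.log x) / Real.log 2 := by gcongr
            _ ≤ 2 * (aA * Real.log x) := by
                rw [div_le_iff₀ (by linarith only [hl2])]
                have hpos : 0 ≤ aA * Real.log x := by positivity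
                have h22 : (1 : ℝ) ≤ 2 * Real.log 2 := by linarith only [hl2]
                nlinarith only [hpos, h22]
        have h4 : (1 : ℝ) ≤ aA * Real.log x :=
          one_le_mul_of_one_le_of_one_le haA1 (by linarith only [hlogx5])
        linarith only [h3, h4]
      calc ∑ n ∈ Icc 1 N, Λ n * Λ (n + h)
          ≤ 2 * ((Nat.log 2 (N + h) : ℝ) + 1) * (Real.log N * Real.log ((N : ℝ) + h)) := h1
        _ ≤ 6 * (aA * Real.log x) * (2 * Real.log x * (aA * Real.log x)) := by
            gcongr
        _ = 12 * aA ^ 2 * Real.log x ^ 3 := by ring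
    -- `log³ x ≤ 729 x^{1/3} ≤ 729 x · x^{-1/1000} ≤ 729 Ke x exp(−C (log x)^{3/5−ε})`
    have hL9 : Real.log x ≤ 9 * x ^ ((1 : ℝ) / 9) :=
      Literature.NumberTheory.Sieve.PrimePairsVonMangoldt.log_le_nine_mul_rpow hx0.le
    have hL3 : Real.log x ^ 3 ≤ 729 * (x * x ^ (-(1 / 1000 : ℝ))) := by
      calc Real.log x ^ 3 ≤ (9 * x ^ ((1 : ℝ) / 9)) ^ 3 := pow_le_pow_left₀ hlogx0.le hL9 3
        _ = 729 * x ^ ((1 : ℝ) / 3) := by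
            rw [mul_pow, ← Real.rpow_natCast (x ^ ((1 : ℝ) / 9)), ← Real.rpow_mul hx0.le]
            norm_num
        _ ≤ 729 * (x * x ^ (-(1 / 1000 : ℝ))) := by
            gcongr
            rw [show x * x ^ (-(1 / 1000 : ℝ)) = x ^ ((1 : ℝ) + -(1 / 1000 : ℝ)) by
              rw [Real.rpow_add hx0, Real.rpow_one]]
            exact Real.rpow_le_rpow_of_exponent_le hx1 (by norm_num)
    have hHe := He x (by linarith)
    calc |(∑ n ∈ Icc 1 N, g (n / x) * (Λ n * Λ (n + h))) -
            x * (∫ u, g u) * goldbachSingularSeries h * (1 + corr)|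
        = |∑ n ∈ Icc 1 N, g (n / x) * (Λ n * Λ (n + h))| := by rw [hmain0, sub_zero]
      _ ≤ 12 * aA ^ 2 * Real.log x ^ 3 := hsmooth.trans hodd_sum
      _ ≤ 12 * aA ^ 2 * (729 * (x * x ^ (-(1 / 1000 : ℝ)))) := by gcongr
      _ ≤ 12 * aA ^ 2 * (729 * (x * (Ke * Real.exp (-C * Real.log x ^ (3 / 5 - ε))))) := by gcongr
      _ = KO * x * Real.exp (-C * Real.log x ^ (3 / 5 - ε)) := by rw [hKO]; ring
      _ ≤ KO * x * E := by gcongr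
      _ ≤ (K₁ + KT + KO) * w * x * E := by
          have h1 : KO * x * E ≤ KO * x * E * w := le_mul_of_one_le_right (by positivity) hw1
          have h2 : 0 ≤ (K₁ + KT) * w * x * E := by positivity
          have e : (K₁ + KT + KO) * w * x * E = KO * x * E * w + (K₁ + KT) * w * x * E := by ring
          rw [e]; linarith only [h1, h2]
  ------------------------------------------------------------------
  -- Core regime: `h` even, `η ≥ η₁ ≥ η₀`, normalised error
  ------------------------------------------------------------------
  have heven : Even h := Nat.not_odd_iff_even.mp hodd
  have hη₁η : η₁ ≤ η := by
    by_contra hlt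
    push Not at hlt
    have : 512 / η₁ ≤ E := by
      calc 512 / η₁ ≤ 512 / η := div_le_div_of_nonneg_left (by norm_num) hη0 hlt.le
        _ ≤ E := hEη
    exact absurd ((min_le_right _ _).trans this) (not_le.mpr hT)
  have hη₀η : η₀ ≤ η := (le_max_left _ _).trans hη₁η
  have hnorm : Real.log x / Real.log q * Real.log η ^ (6 : ℕ) / η ≤ 1 :=
    (hE3.trans hT.le).trans hc₀1
  have hcore := H₁ q hq χ hprim hquad η hη hη₀η hL x hx hnorm δ hδ hδup hδ2 h hh heven hhA
  calc |(∑ n ∈ Icc 1 N, g (n / x) * (Λ n * Λ (n + h))) -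
          x * (∫ u, g u) * goldbachSingularSeries h * (1 + corr)|
      ≤ K₁ * w * x * E := hcore
    _ ≤ (K₁ + KT + KO) * w * x * E := by
        have h0 : 0 ≤ (KT + KO) * w * x * E := by positivity
        have e : (K₁ + KT + KO) * w * x * E = K₁ * w * x * E + (KT + KO) * w * x * E := by ring
        rw [e]; linarith only [h0]

end MMSmoothing

open MMSmoothing in
/-- **Matomäki–Merikoski Theorem 1.3 from its core regime.**  The named fact
`MatomakiMerikoski2023_pairCorrelation` follows from the smoothed dyadic statement restricted to even
shifts, `η ≥ η₀(C, ε, A)` and `(log x/log q) log⁶η/η ≤ 1` (`MMSmoothing.smoothed_of_core` composed with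
`MatomakiMerikoski2023_pairCorrelation_of_smoothed'`).  The hypothesis is what §§2–7 of the source prove;
it is NOT proved here. [cite: MatomakiMerikoski2023, §2 and §7 (first paragraphs)] -/
theorem MatomakiMerikoski2023_pairCorrelation_of_core
    (Hcore : ∀ C : ℝ, 1 ≤ C → ∀ ε : ℝ, 0 < ε → ∀ A : ℝ, 0 < A → ∃ η₀ K : ℝ, 0 < K ∧
      ∀ (q : ℕ) [NeZero q], 3 ≤ q → ∀ χ : DirichletCharacter ℂ q, χ.IsPrimitive → χ.IsQuadratic →
        ∀ η : ℝ, 10 ≤ η → η₀ ≤ η → χ.LFunction ((1 - 1 / (η * Real.log q) : ℝ) : ℂ) = 0 →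
          ∀ x : ℝ, (q : ℝ) ^ (37 / 4 : ℝ) ≤ x → Real.log x / Real.log q * Real.log η ^ (6 : ℕ) / η ≤ 1 →
            ∀ δ : ℝ, x ^ (-(1 / 999 : ℝ)) / 4 ≤ δ → δ ≤ x ^ (-(1 / 1000 : ℝ)) → δ ≤ 1 / 2 →
            ∀ h : ℕ, 1 ≤ h → Even h → (h : ℝ) ≤ A * x ^ (1 + 1 / 3999 : ℝ) →
              |(∑ n ∈ Icc 1 ⌊2 * x⌋₊,
                  plateauCutoff (1 + δ) (2 - δ) δ (n / x) * (Λ n * Λ (n + h))) -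
                  x * (∫ u, plateauCutoff (1 + δ) (2 - δ) δ u) * goldbachSingularSeries h *
                    (1 + if Nat.totient (2 ^ padicValNat 2 q) ∣ h then
                          (-1 : ℝ) ^ (h / Nat.totient (2 ^ padicValNat 2 q)) *
                            ∏ p ∈ (q / 2 ^ padicValNat 2 q).primeFactors.filter (fun p => ¬ p ∣ h),
                              (-1 : ℝ) / ((p : ℝ) - 2)
                        else 0)| ≤
                K * ((h : ℝ) / (Nat.totient h : ℝ)) * x *
                  (Real.exp (-C * Real.sqrt (Real.log x / Real.log q * Real.log η)) +
                    Real.exp (-C * Real.log x ^ (3 / 5 - ε)) +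
                    Real.log x / Real.log q * Real.log η ^ (6 : ℕ) / η)) :
    MatomakiMerikoski2023_pairCorrelation :=
  MatomakiMerikoski2023_pairCorrelation_of_smoothed' (smoothed_of_core Hcore)

end Literature.Barriers.Parity
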